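import Mathlib
import Literature.AlgebraicGeometry.HodgeTheory.CartierDivisorChernClass
import Literature.Geometry.Kaehler.HolomorphicLineBundleSections
import HarnessLib

/-!
# SerreTheoremALineBundles

Topic `Literature/AlgebraicGeometry/HodgeTheory`. Named literature fact(s) relocated by the gate from `Summits/HodgeConjecture/HodgeConjecture/Theorems/NikulinTwinTransportLefschetzOneOneK3SerreTheoremA.lean`
(accept-time relocation of `[cite]`d propositions written inline in a Summits proposal; human ruling 2026-08-15).
Sources: GortzWedhorn2020, SerreGAGA1956.

* `Literature.AlgebraicGeometry.HodgeTheory.serre_theoremA_lineCocycle_surface`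
-/

namespace Literature.AlgebraicGeometry.HodgeTheory

/-- **Serre's Théorème A for the sheaf of sections of a holomorphic line cocycle on a smooth projective
surface, sections form** (J.-P. Serre, *Géométrie algébrique et géométrie analytique* (1956), n° 16,
Théorème A: for a coherent analytic sheaf `𝓜` on `ℙ_r(ℂ)^h` there is `n(𝓜)` such that `𝓜(n)_x` is
generated by `H⁰(ℙ_r(ℂ)^h, 𝓜(n))` for all `n ≥ n(𝓜)` and all `x`; applied to the extension by zero of
the sheaf of sections of a holomorphic line cocycle `L` on `X^h`, `X ⊂ ℙ_r` a smooth projective surface,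
for which `𝓜(n)|_{X^h} = L ⊗ 𝒪_X(n)^an` and `𝒪_X(n) = 𝒪_X(D)`, `D = n·(hyperplane section)`, carries
the non-zero algebraic section `1`). In the tree's vocabulary: for `X` smooth projective of dimension
`2` over `ℂ` with Hodge model `A` and every holomorphic line cocycle `L` on `A.carrier ≅ X^an`
(`HolomorphicLineBundle`), there are a Cartier divisor `D` on `X` with a non-zero algebraic global
section `s ∈ Γ(X, 𝒪_X(D))` (`CartierDivisor.IsSection`, Görtz–Wedhorn I (11.9)) and a NON-ZERO
holomorphic global section of `L ⊗ 𝒪_X(D)^an` (`HolomorphicLineBundle.tensor`,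
`cartierDivisorLineBundle`, `GlobalSection.zeroSet ≠ univ`). It follows from GAGA for line bundles
(`serreGAGA_lineCocycle_iso_cartierDivisorCocycle`) with the algebraic theorem A, and — without
Théorème 3, Kodaira vanishing or Serre duality — from Cartan–Serre finiteness for `H^{0,q}_∂̄(X^an; L)`
and the two long exact sequences of restriction to a smooth hyperplane section and to points (module
docstring of `NikulinTwinTransportLefschetzOneOneK3EulerCharacteristic`). [cite: SerreGAGA1956, n° 16–17 Théorèmes A–B and n° 12 Théorème 3]
[cite: GortzWedhorn2020, Section (11.9) (p. 374)] [file AlgebraicGeometry/HodgeTheory/SerreTheoremALineBundles] -/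
def serre_theoremA_lineCocycle_surface : Prop :=
  ∀ ⦃X : Literature.AlgebraicGeometry.Motives.SchemeOver ℂ⦄
    (hX : Literature.AlgebraicGeometry.Motives.IsSmoothProjective 2 X),
    letI : AlgebraicGeometry.IsIntegral X.left :=
      Literature.AlgebraicGeometry.Motives.IsSmoothProjective.isIntegral_holds hX
    ∀ (A : Literature.AlgebraicGeometry.HodgeTheory.HodgeModel 2 X) (ι : Type)
      (L : Literature.Geometry.Kaehler.HolomorphicLineBundle ι A.model A.carrier),
      ∃ (D : Literature.AlgebraicGeometry.Motives.CartierDivisor X.left) (s : X.left.functionField)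
        (_ : D.IsSection s), s ≠ 0 ∧
        ∃ σ : (L.tensor (Literature.AlgebraicGeometry.HodgeTheory.cartierDivisorLineBundle
          A.isAnalytification D)).GlobalSection, σ.zeroSet ≠ Set.univ
-- TODO(general form): Serre proves it for every coherent analytic sheaf on `ℙ_r(ℂ)^h` (all dimensions,
-- with generation of all stalks `𝓜(n)_x` for `n ≥ n(𝓜)`); the surface / line-cocycle / one-section
-- slice is the input of `lefschetzOneOneK3_of_exists_section_algebraicTwist`.

end Literature.AlgebraicGeometry.HodgeTheory
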